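import Mathlib

/-!
# Route SymmetroidDescartes — refutation of `DerivedPencilRolle` (stmt-ValiantsHypothesis-18500), part 0:
layered weighted walks (shared definitions)

The refutation of the crux `DerivedPencilRolle` exhibits symmetric lacunary pencils whose determinants
have super-polynomially many sign alternations.  Such determinants are obtained from PATH POLYNOMIALS of
layered weighted digraphs (a parametric-shortest-path construction in the spirit of Carstensen 1983 /
Mulmuley–Shah 2001, here a mirror-free "staircase" variant with O(L) exponent classes), by the block
determinant `det (I − Z₀ − W·u vᵀ) = 1 − W·(path sum)` and the tree's symmetrisation
(`hasSymmAffineDetRepr_of_hasDetRepr`, `exists_symm_pencil_eval`).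

This file only fixes the shared vocabulary:

* `WEdge K` — an edge label: integer weight `a` (the exponent of a small real base `η`), an exponent
  class `cls : Fin K` (the actual `t`-exponent is `d cls` for an exponent table `d : Fin K → ℕ`) and a
  sign bit `neg`;
* `WLayer V K := V → V → Option (WEdge K)` — one layer of a layered digraph on the vertex set `V`; a
  layered graph is a `List (WLayer V K)`; a WALK from a start vertex `v` is the list of the vertices
  visited after `v` (one per layer);
* `walkCost d lam g v w : WithTop ℤ` — tropical cost `Σ (a − lam · d cls)` of a walk at the integer
  parameter `lam` (`⊤` if an edge is missing or the lengths do not match);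
* `walkSign g v w : ℤ` — the product of the signs `(-1)^neg` along the walk (junk `1` on missing edges);
* `stepVal / walkVal d η t` — the real entry `(-1)^neg · η^a · t^(d cls)` of an edge (`0` if missing) and
  the product along a walk; `layerMat d η t l : Matrix V V ℝ` — the real matrix of a layer.

Design: walks are `List`s (not `Fin`-indexed functions) so that concatenation of graphs and walks needs
no casts; costs live in `WithTop ℤ` so that lower bounds propagate through missing edges.
Besides `rfl`-level unfolding lemmas and the concatenation API (`walkCost_append`, …), the file
proves the arithmetic stub `stub_arith` of the skeleton (the choice of the parameters `n, L`).
-/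

-- single-conjunct layout: Sub = Summit, duplicated namespace component intended
set_option linter.dupNamespace false

namespace Summit.ValiantsHypothesis.ValiantsHypothesis.Theorems.SymmetroidDescartes.DPR

/-- An edge label of a layered weighted digraph: weight `a : ℤ` (exponent of the small base `η`),
exponent class `cls : Fin K` (the `t`-exponent is read off an exponent table `d : Fin K → ℕ`), and a
sign bit `neg` (the real entry carries the sign `(-1)^neg`). [folklore] -/
structure WEdge (K : ℕ) where
  /-- weight: the exponent of the small real base `η` -/
  a : ℤ
  /-- exponent class: index into the exponent table `d : Fin K → ℕ` -/
  cls : Fin K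
  /-- sign bit: the real entry is multiplied by `-1` iff `neg` -/
  neg : Bool
deriving DecidableEq

/-- One layer of a layered weighted digraph on the vertex set `V`: `l v v' = some e` iff there is an
edge `v → v'` with label `e` between this column and the next. [folklore] -/
abbrev WLayer (V : Type*) (K : ℕ) := V → V → Option (WEdge K)

/-- The sign `(-1)^neg ∈ {1, -1} ⊂ ℤ` of an edge label. [folklore] -/
def WEdge.sgn {K : ℕ} (e : WEdge K) : ℤ := if e.neg then -1 else 1

/-- Tropical cost of one step at the integer parameter `lam` for the exponent table `d`:
`a − lam · d cls`, and `⊤` for a missing edge. [folklore] -/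
def stepCost {K : ℕ} (d : Fin K → ℕ) (lam : ℤ) : Option (WEdge K) → WithTop ℤ
  | none => ⊤
  | some e => ((e.a - lam * (d e.cls : ℤ) : ℤ) : WithTop ℤ)

/-- Tropical cost of a walk.  The walk through the layered graph `g` starts at `v` and `w` lists the
vertices visited after `v`, one per layer; the cost is the sum of the step costs, and `⊤` if some edge
is missing or `w.length ≠ g.length`. [folklore] -/
def walkCost {V : Type*} {K : ℕ} (d : Fin K → ℕ) (lam : ℤ) :
    List (WLayer V K) → V → List V → WithTop ℤ
  | [], _, [] => 0
  | l :: g, v, v' :: w => stepCost d lam (l v v') + walkCost d lam g v' w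
  | [], _, _ :: _ => ⊤
  | _ :: _, _, [] => ⊤

/-- Sign of a walk: the product of the edge signs `(-1)^neg` along it (a missing edge or a length
mismatch contributes the junk factor `1`; only walks of finite cost matter). [folklore] -/
def walkSign {V : Type*} {K : ℕ} : List (WLayer V K) → V → List V → ℤ
  | [], _, _ => 1
  | _ :: _, _, [] => 1
  | l :: g, v, v' :: w => (match l v v' with | none => 1 | some e => e.sgn) * walkSign g v' w

/-- Real value of one step at base `η` and point `t`: `(-1)^neg · η^a · t^(d cls)` (`η^a` an integer
power), and `0` for a missing edge. [folklore] -/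
noncomputable def stepVal {K : ℕ} (d : Fin K → ℕ) (η t : ℝ) : Option (WEdge K) → ℝ
  | none => 0
  | some e => (e.sgn : ℝ) * η ^ e.a * t ^ (d e.cls)

/-- Real value of a walk: the product of its step values (`0` if an edge is missing or the lengths do
not match, `1` for the empty walk through the empty graph). [folklore] -/
noncomputable def walkVal {V : Type*} {K : ℕ} (d : Fin K → ℕ) (η t : ℝ) :
    List (WLayer V K) → V → List V → ℝ
  | [], _, [] => 1
  | l :: g, v, v' :: w => stepVal d η t (l v v') * walkVal d η t g v' w
  | [], _, _ :: _ => 0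
  | _ :: _, _, [] => 0

/-- The real matrix of a layer at base `η` and point `t`: entry `(v, v')` is the step value of the edge
`v → v'`. [folklore] -/
noncomputable def layerMat {V : Type*} {K : ℕ} (d : Fin K → ℕ) (η t : ℝ) (l : WLayer V K) :
    Matrix V V ℝ :=
  Matrix.of fun v v' => stepVal d η t (l v v')

/-- The path sum of a layered graph from `v₀`: the sum over all end vertices `x` of the `(v₀, x)` entry
of the product of the layer matrices, i.e. the sum of the values of all walks from `v₀`. [folklore] -/
noncomputable def pathSum {V : Type*} [Fintype V] [DecidableEq V] {K : ℕ} (d : Fin K → ℕ) (η t : ℝ)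
    (g : List (WLayer V K)) (v₀ : V) : ℝ :=
  ∑ x, (g.map (layerMat d η t)).prod v₀ x

section unfolding

variable {V : Type*} {K : ℕ} (d : Fin K → ℕ)

/-- `walkCost` of the empty walk through the empty graph is `0`. [folklore] -/
@[simp] theorem walkCost_nil_nil (lam : ℤ) (v : V) :
    walkCost d lam ([] : List (WLayer V K)) v [] = 0 := rfl

/-- `walkCost` unfolds one layer. [folklore] -/
@[simp] theorem walkCost_cons_cons (lam : ℤ) (l : WLayer V K) (g : List (WLayer V K)) (v v' : V)
    (w : List V) :
    walkCost d lam (l :: g) v (v' :: w) = stepCost d lam (l v v') + walkCost d lam g v' w := rfl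

/-- A walk that is too long for the empty graph has cost `⊤`. [folklore] -/
@[simp] theorem walkCost_nil_cons (lam : ℤ) (v v' : V) (w : List V) :
    walkCost d lam ([] : List (WLayer V K)) v (v' :: w) = ⊤ := rfl

/-- A walk that is too short has cost `⊤`. [folklore] -/
@[simp] theorem walkCost_cons_nil (lam : ℤ) (l : WLayer V K) (g : List (WLayer V K)) (v : V) :
    walkCost d lam (l :: g) v [] = ⊤ := rfl

/-- `walkVal` of the empty walk through the empty graph is `1`. [folklore] -/
@[simp] theorem walkVal_nil_nil (η t : ℝ) (v : V) :
    walkVal d η t ([] : List (WLayer V K)) v [] = 1 := rfl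

/-- `walkVal` unfolds one layer. [folklore] -/
@[simp] theorem walkVal_cons_cons (η t : ℝ) (l : WLayer V K) (g : List (WLayer V K)) (v v' : V)
    (w : List V) :
    walkVal d η t (l :: g) v (v' :: w) = stepVal d η t (l v v') * walkVal d η t g v' w := rfl

/-- A walk that is too long for the empty graph has value `0`. [folklore] -/
@[simp] theorem walkVal_nil_cons (η t : ℝ) (v v' : V) (w : List V) :
    walkVal d η t ([] : List (WLayer V K)) v (v' :: w) = 0 := rfl

/-- A walk that is too short has value `0`. [folklore] -/
@[simp] theorem walkVal_cons_nil (η t : ℝ) (l : WLayer V K) (g : List (WLayer V K)) (v : V) :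
    walkVal d η t (l :: g) v [] = 0 := rfl

/-- `walkSign` unfolds one layer. [folklore] -/
@[simp] theorem walkSign_cons_cons (l : WLayer V K) (g : List (WLayer V K)) (v v' : V) (w : List V) :
    walkSign (l :: g) v (v' :: w)
      = (match l v v' with | none => 1 | some e => e.sgn) * walkSign g v' w := rfl

/-- `walkSign` through the empty graph is `1`. [folklore] -/
@[simp] theorem walkSign_nil (v : V) (w : List V) : walkSign ([] : List (WLayer V K)) v w = 1 := by
  cases w <;> rfl

/-- `layerMat` entries are step values. [folklore] -/
@[simp] theorem layerMat_apply (η t : ℝ) (l : WLayer V K) (v v' : V) :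
    layerMat d η t l v v' = stepVal d η t (l v v') := rfl

end unfolding

section append

variable {V : Type*} {K : ℕ} (d : Fin K → ℕ)

/-- The last vertex of a walk starting at `v` (the start itself for the empty walk). [folklore] -/
def walkLast (v : V) (w : List V) : V := w.getLastD v

/-- `walkLast` of a nonempty walk ignores the start. [folklore] -/
@[simp] theorem walkLast_cons (v v' : V) (w : List V) : walkLast v (v' :: w) = walkLast v' w := by
  cases w <;> rfl

/-- `walkLast` of the empty walk is the start. [folklore] -/
@[simp] theorem walkLast_nil (v : V) : walkLast v ([] : List V) = v := rfl

/-- A walk of finite cost has the length of the graph. [folklore] -/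
theorem length_eq_of_walkCost_ne_top (lam : ℤ) :
    ∀ (g : List (WLayer V K)) (v : V) (w : List V), walkCost d lam g v w ≠ ⊤ → w.length = g.length
  | [], _, [], _ => rfl
  | [], _, _ :: _, h => (h rfl).elim
  | _ :: _, _, [], h => (h rfl).elim
  | l :: g, v, v' :: w, h => by
      rw [walkCost_cons_cons, WithTop.add_ne_top] at h
      simp [length_eq_of_walkCost_ne_top lam g v' w h.2]

/-- Cost of a walk through a concatenated graph: when the first part of the walk has the length of the
first graph, the cost is the sum of the two costs (the second walk starts where the first ends).
[folklore] -/
theorem walkCost_append (lam : ℤ) :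
    ∀ (g₁ g₂ : List (WLayer V K)) (v : V) (w₁ w₂ : List V), w₁.length = g₁.length →
      walkCost d lam (g₁ ++ g₂) v (w₁ ++ w₂)
        = walkCost d lam g₁ v w₁ + walkCost d lam g₂ (walkLast v w₁) w₂
  | [], g₂, v, [], w₂, _ => by simp
  | [], _, _, _ :: _, _, h => by simp at h
  | _ :: _, _, _, [], _, h => by simp at h
  | l :: g₁, g₂, v, v' :: w₁, w₂, h => by
      simp only [List.cons_append, walkCost_cons_cons, walkLast_cons]
      rw [walkCost_append lam g₁ g₂ v' w₁ w₂ (by simpa using h), add_assoc]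

/-- Sign of a walk through a concatenated graph (first part of matching length). [folklore] -/
theorem walkSign_append :
    ∀ (g₁ g₂ : List (WLayer V K)) (v : V) (w₁ w₂ : List V), w₁.length = g₁.length →
      walkSign (g₁ ++ g₂) v (w₁ ++ w₂) = walkSign g₁ v w₁ * walkSign g₂ (walkLast v w₁) w₂
  | [], g₂, v, [], w₂, _ => by simp
  | [], _, _, _ :: _, _, h => by simp at h
  | _ :: _, _, _, [], _, h => by simp at h
  | l :: g₁, g₂, v, v' :: w₁, w₂, h => by
      simp only [List.cons_append, walkSign_cons_cons, walkLast_cons]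
      rw [walkSign_append g₁ g₂ v' w₁ w₂ (by simpa using h), mul_assoc]

/-- Value of a walk through a concatenated graph (first part of matching length). [folklore] -/
theorem walkVal_append (η t : ℝ) :
    ∀ (g₁ g₂ : List (WLayer V K)) (v : V) (w₁ w₂ : List V), w₁.length = g₁.length →
      walkVal d η t (g₁ ++ g₂) v (w₁ ++ w₂)
        = walkVal d η t g₁ v w₁ * walkVal d η t g₂ (walkLast v w₁) w₂
  | [], g₂, v, [], w₂, _ => by simp
  | [], _, _, _ :: _, _, h => by simp at h
  | _ :: _, _, _, [], _, h => by simp at h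
  | l :: g₁, g₂, v, v' :: w₁, w₂, h => by
      simp only [List.cons_append, walkVal_cons_cons, walkLast_cons]
      rw [walkVal_append η t g₁ g₂ v' w₁ w₂ (by simpa using h), mul_assoc]

/-- Splitting a walk of finite cost through a concatenated graph at the seam. [folklore] -/
theorem walkCost_append_split (lam : ℤ) (g₁ g₂ : List (WLayer V K)) (v : V) (w : List V)
    (h : walkCost d lam (g₁ ++ g₂) v w ≠ ⊤) :
    (w.take g₁.length).length = g₁.length ∧ w = w.take g₁.length ++ w.drop g₁.length ∧
      walkCost d lam (g₁ ++ g₂) v w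
        = walkCost d lam g₁ v (w.take g₁.length)
          + walkCost d lam g₂ (walkLast v (w.take g₁.length)) (w.drop g₁.length) := by
  have hlen := length_eq_of_walkCost_ne_top d lam _ v w h
  have h1 : (w.take g₁.length).length = g₁.length := by
    rw [List.length_take, hlen, List.length_append]
    exact min_eq_left (Nat.le_add_right _ _)
  refine ⟨h1, (List.take_append_drop _ _).symm, ?_⟩
  conv_lhs => rw [← List.take_append_drop g₁.length w]
  exact walkCost_append d lam g₁ g₂ v _ _ h1

end append


/-! ### The arithmetic stub -/

/-- Size bookkeeping for the staircase family: `((E-1)(n+1)+1)·(E·n·2) ≤ 4·E²·n²` for `n ≥ 1`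
(`E = 2^L`: the number of columns times the number of vertices per column). [folklore] -/
theorem size_le (E n : ℕ) (hn : 1 ≤ n) :
    ((E - 1) * (n + 1) + 1) * (E * n * 2) ≤ 4 * E ^ 2 * n ^ 2 := by
  rcases Nat.eq_zero_or_pos E with hE | hE
  · subst hE; simp
  have h1 : (E - 1) * (n + 1) + 1 ≤ E * (2 * n) := by
    have : (E - 1) * (n + 1) + 1 ≤ (E - 1) * (2 * n) + 2 * n := by nlinarith
    calc (E - 1) * (n + 1) + 1 ≤ (E - 1) * (2 * n) + 1 * (2 * n) := by nlinarith
      _ = (E - 1 + 1) * (2 * n) := by ring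
      _ = E * (2 * n) := by rw [Nat.sub_add_cancel hE]
  calc ((E - 1) * (n + 1) + 1) * (E * n * 2) ≤ (E * (2 * n)) * (E * n * 2) :=
        Nat.mul_le_mul_right _ h1
    _ = 4 * E ^ 2 * n ^ 2 := by ring

/-- The arithmetic stub `stub_arith` of the refutation skeleton (line `staircase-refutation` of crux
stmt-ValiantsHypothesis-18500): with `L = 6a + 1` levels there is an even `n ≥ 2` such that `n^L − 1`
alternations beat the iterated-Rolle bound `K · C^K · (m + K)^a` for `K = 6a + 3` classes and the
symmetrised size `m = 4·m₀³ + 7`, `m₀ = ((2^L − 1)(n+1) + 1) · (2^L · n · 2)`.  Proof: with `L = 6a+1`, `F = 256·4^{3L}… = 256·E^6 + L + 9` and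
`D = (L+2)·C^{L+2}·F^a`, the even number `n = 2(D+1)` gives `n^L = n^{6a}·n ≥ D·n^{6a} + 2` while the
Rolle bound is at most `D·n^{6a}`. [folklore] -/
theorem stub_arith : ∀ C a : ℕ, ∃ n : ℕ, 2 ≤ n ∧ Even n ∧ (6 * a + 3) * C ^ (6 * a + 3) * (4 * (((2 ^ (6 * a + 1) - 1) * (n + 1) + 1) * (2 ^ (6 * a + 1) * n * 2)) ^ 3 + 7 + (6 * a + 3)) ^ a < n ^ (6 * a + 1) - 1 := by
  intro C a
  set L := 6 * a + 1 with hL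
  set E := 2 ^ L with hE
  set F := 256 * E ^ 6 + L + 9 with hF
  set D := (L + 2) * C ^ (L + 2) * F ^ a with hD
  refine ⟨2 * (D + 1), by omega, even_two_mul _, ?_⟩
  set n := 2 * (D + 1) with hn
  have hn1 : 1 ≤ n := by omega
  -- the symmetrised size is at most `F · n^6`
  have hsize : 4 * (((E - 1) * (n + 1) + 1) * (E * n * 2)) ^ 3 + 7 + (L + 2) ≤ F * n ^ 6 := by
    have h1 := size_le E n hn1
    have h2 : (((E - 1) * (n + 1) + 1) * (E * n * 2)) ^ 3 ≤ (4 * E ^ 2 * n ^ 2) ^ 3 :=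
      Nat.pow_le_pow_left h1 3
    have h3 : 1 ≤ n ^ 6 := Nat.one_le_pow _ _ hn1
    calc 4 * (((E - 1) * (n + 1) + 1) * (E * n * 2)) ^ 3 + 7 + (L + 2)
        ≤ 4 * (4 * E ^ 2 * n ^ 2) ^ 3 + (7 + (L + 2)) * n ^ 6 := by nlinarith
      _ = F * n ^ 6 := by rw [hF]; ring
  have hK : 6 * a + 3 = L + 2 := by omega
  rw [hK]
  have hbound : (L + 2) * C ^ (L + 2) *
      (4 * (((E - 1) * (n + 1) + 1) * (E * n * 2)) ^ 3 + 7 + (L + 2)) ^ a ≤ D * n ^ (6 * a) := by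
    calc (L + 2) * C ^ (L + 2) * (4 * (((E - 1) * (n + 1) + 1) * (E * n * 2)) ^ 3 + 7 + (L + 2)) ^ a
        ≤ (L + 2) * C ^ (L + 2) * (F * n ^ 6) ^ a :=
          Nat.mul_le_mul_left _ (Nat.pow_le_pow_left hsize a)
      _ = D * n ^ (6 * a) := by rw [hD, mul_pow, ← pow_mul]; ring
  have hpow : 1 ≤ n ^ (6 * a) := Nat.one_le_pow _ _ hn1
  have hmain : D * n ^ (6 * a) + 2 ≤ n ^ L := by
    have h1 : n ^ L = n ^ (6 * a) * n := by rw [hL, pow_succ]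
    have h2 : n ^ (6 * a) * n = 2 * (D * n ^ (6 * a)) + 2 * n ^ (6 * a) := by
      rw [hn]; ring
    rw [h1, h2]
    omega
  omega


end Summit.ValiantsHypothesis.ValiantsHypothesis.Theorems.SymmetroidDescartes.DPR
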